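import Summits.QuantumFields.YangMills.Theorems.LuscherReductionDressedRitzLocatedLevels
import Summits.QuantumFields.YangMills.Theorems.LuscherReductionDressedRitzVacuumDictionary
import HarnessLib

/-!
# Route `LuscherReduction`, item `DressedRitz` (stmt-QuantumFields-20205) — the HANDOVER SHADOW: item 20205 alone puts a running zero-flux level
# within `C·Λ^{3/2}/L` (relative) of EVERY one-site position `μ_i/μ₀`, in RED's product form and index-free

Prover seat ymfull-r2b-prover-1 (cell ym-gapexp, R590-ym item (10)), `--supports stmt-QuantumFields-20205 --as helper`.

WHAT.  `…DressedRitzLocatedLevels` (this seat, p783854) showed: along the femto window the family of the slice `KTGen.DressedRitzAt k` has, for every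
`i ≤ k`, a running level `λ_j = levelValue su2Rep L β j` with `(λ_j − m_i)²·m_i ≤ C(Λ³/L²)m₀²λ₀` (Weinstein enclosure at the (ii′) rate), `m_i > 0`,
`λ₀ ≤ e^{ηΛ/L}m₀`.  Here this is combined with the slice's own POSITION clause (e) (`m_i/m₀ = μ_i/μ₀` to `e^{±CΛ²/L}`, `μ_j` the ONE-SITE levels at
`B = oneSiteCoupling β L`) and the closed crux ONE (`oneSiteLevels_proof`: `μ₀ ≤ M_k·μ_i`, `M_k = e^{|ε_k|+|C₁|}`) into RED's currency:

* `KTGen.shadow_sq_algebra` — the pure-real step: `(λ_jμ₀ − μ_im₀)² ≤ 2(λ_j−m_i)²μ₀² + 2(m_iμ₀ − μ_im₀)²`, the first term `≤ 9MC·(Λ³/L²)(m₀μ₀)²`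
  (Weinstein + (e) + top capture), the second `≤ 36C²·(Λ³/L²)(m₀μ₀)²` ((e): `|m_iμ₀ − μ_im₀| ≤ 6|a|μ₀m₀`, `a = CΛ²/L`, `|e^a − 1| ≤ 2|a|`);
* ★★ `KTGen.handoverShadow_of_dressedRitzAt : DressedRitzAt k → ∀ η>0 ∃ C' lam0 … window … ∃ φ` (physical, orthonormal, `m_i > 0`,
  `m₀ ≤ λ₀ ≤ e^{ηΛ/L}m₀`) `∧ ∀ i ≤ k, ∃ j, (λ_j·μ₀ − μ_i·m₀)² ≤ C'·(Λ³/L²)·(m₀μ₀)²`, and `KTGen.handoverShadow_of_dressedRitz` (item BY NAME).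

READING (honest).  RED (`RunningReduction`) says `λ_i/λ₀ = μ_i/μ₀·e^{±CΛ²/L}` WITH THE INDEX; item 20205 alone gives, for each one-site position
`μ_i/μ₀`, SOME running level at relative distance `≤ √C'·Λ^{3/2}/L` from `(μ_i/μ₀)·(m₀/λ₀)` — finer than the spacing `≍ Λ/L` of distinct
`𝔥`-levels, coarser than RED's `Λ²/L`, and blind to the index (intruder levels are not excluded: that is exactly the no-intruder input of the KT door
`KTDoorR3.katoTempleDoorR3` ∕ KTR r8 stub 3b′).  The normalisation is the family's top Ritz value `m₀` (`m₀ ≤ λ₀ ≤ e^{ηΛ/L}m₀`, `η` free).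

HONEST FRAMING: fixed-lattice spectral bookkeeping plus the closed one-site crux on the CONDITIONAL femto rung R2b1 (finite volume); a CONSEQUENCE of
item 20205, not a proof of it; nothing here bears on infinite volume, the continuum limit or the Clay mass gap — the Yang–Mills mass gap is NOT proved.
References: T. Kato, J. Phys. Soc. Japan 4 (1949) 334 [cite: Kato1949, Lemma 1]; M. Lüscher, NPB 219 (1983) 233 [cite: Luscher1983, §3].
-/

set_option autoImplicit false

noncomputable section

open MeasureTheory Filter Topology Real
open Literature.MathematicalPhysics.QuantumFieldTheory
open Literature.MathematicalPhysics.QuantumLattice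
open Literature.Analysis.OperatorTheory.YMMatrixModel
open scoped BigOperators

namespace Summit.QuantumFields.YangMills.Theorems.FemtoTransferGap

open Summit.QuantumFields.YangMills.Theorems.FemtoTransferGap.KTRCalibration

/-! ## §1 The pure-real step -/

/-- **Shadow algebra (pure real).**  From the located-level bound `(λ_j − m_i)²m_i ≤ C·x·m₀²·λ₀` (`x = Λ³/L²`), the position pair
`μ_im₀ ≤ e^a m_iμ₀`, `m_iμ₀ ≤ e^a μ_im₀` (`|a| ≤ 1`, `a² ≤ C²x`), top capture `λ₀ ≤ e^b m₀` (`b ≤ 1`) and the one-site data `μ_i ≤ μ₀ ≤ Mμ_i`: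
`(λ_jμ₀ − μ_im₀)² ≤ (18MC + 72C²)·x·(m₀μ₀)²`. [folklore] -/
theorem KTGen.shadow_sq_algebra {lj mi m0 μi μ0 l0 C x a b M : ℝ}
    (hmi : 0 < mi) (hm0 : 0 < m0) (hμi : 0 < μi) (hμ0 : 0 < μ0)
    (hC : 0 ≤ C) (hx : 0 ≤ x) (ha : |a| ≤ 1) (hb : b ≤ 1) (haC : a ^ 2 ≤ C ^ 2 * x)
    (hM : μ0 ≤ M * μi) (hμle : μi ≤ μ0)
    (h1 : (lj - mi) ^ 2 * mi ≤ C * x * m0 ^ 2 * l0)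
    (h2 : μi * m0 ≤ Real.exp a * (mi * μ0)) (h3 : mi * μ0 ≤ Real.exp a * (μi * m0))
    (h4 : l0 ≤ Real.exp b * m0) :
    (lj * μ0 - μi * m0) ^ 2 ≤ (18 * M * C + 72 * C ^ 2) * x * (m0 * μ0) ^ 2 := by
  have he3 : Real.exp 1 ≤ 3 := by have := Real.exp_one_lt_d9; linarith
  have hEa : Real.exp a ≤ 3 := (Real.exp_le_exp.2 ((le_abs_self a).trans ha)).trans he3
  have hEb : Real.exp b ≤ 3 := (Real.exp_le_exp.2 hb).trans he3
  have hM0 : 0 ≤ M := (pos_of_mul_pos_left (hμ0.trans_le hM) hμi.le).le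
  have hmm : 0 < μ0 * m0 := mul_pos hμ0 hm0
  -- Term A: `((λ_j − m_i)μ₀)² ≤ 9MC·x·(m₀μ₀)²`
  have hA1 : (lj - mi) ^ 2 * (μi * m0) ≤ Real.exp a * μ0 * (C * x * m0 ^ 2 * l0) := by
    calc (lj - mi) ^ 2 * (μi * m0) ≤ (lj - mi) ^ 2 * (Real.exp a * (mi * μ0)) :=
          mul_le_mul_of_nonneg_left h2 (sq_nonneg _)
      _ = Real.exp a * μ0 * ((lj - mi) ^ 2 * mi) := by ring
      _ ≤ Real.exp a * μ0 * (C * x * m0 ^ 2 * l0) := mul_le_mul_of_nonneg_left h1 (by positivity)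
  have hA2 : (lj - mi) ^ 2 * (μi * m0) ≤ 9 * μ0 * (C * x * m0 ^ 3) := by
    calc (lj - mi) ^ 2 * (μi * m0) ≤ Real.exp a * μ0 * (C * x * m0 ^ 2 * l0) := hA1
      _ ≤ Real.exp a * μ0 * (C * x * m0 ^ 2 * (Real.exp b * m0)) :=
          mul_le_mul_of_nonneg_left (mul_le_mul_of_nonneg_left h4 (by positivity)) (by positivity)
      _ = (Real.exp a * Real.exp b) * (μ0 * (C * x * m0 ^ 3)) := by ring
      _ ≤ (3 * 3) * (μ0 * (C * x * m0 ^ 3)) :=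
          mul_le_mul_of_nonneg_right (mul_le_mul hEa hEb (Real.exp_pos b).le (by norm_num)) (by positivity)
      _ = 9 * μ0 * (C * x * m0 ^ 3) := by ring
  have hA3 : (lj - mi) ^ 2 * μi ≤ 9 * C * x * m0 ^ 2 * μ0 := by
    have h' : ((lj - mi) ^ 2 * μi) * m0 ≤ (9 * C * x * m0 ^ 2 * μ0) * m0 := by
      calc ((lj - mi) ^ 2 * μi) * m0 = (lj - mi) ^ 2 * (μi * m0) := by ring
        _ ≤ 9 * μ0 * (C * x * m0 ^ 3) := hA2
        _ = (9 * C * x * m0 ^ 2 * μ0) * m0 := by ring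
    exact le_of_mul_le_mul_right h' hm0
  have hA4 : (lj - mi) ^ 2 * μ0 ≤ 9 * M * C * x * m0 ^ 2 * μ0 := by
    calc (lj - mi) ^ 2 * μ0 ≤ (lj - mi) ^ 2 * (M * μi) := mul_le_mul_of_nonneg_left hM (sq_nonneg _)
      _ = M * ((lj - mi) ^ 2 * μi) := by ring
      _ ≤ M * (9 * C * x * m0 ^ 2 * μ0) := mul_le_mul_of_nonneg_left hA3 hM0
      _ = 9 * M * C * x * m0 ^ 2 * μ0 := by ring
  have hA : ((lj - mi) * μ0) ^ 2 ≤ 9 * M * C * x * (m0 * μ0) ^ 2 := by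
    calc ((lj - mi) * μ0) ^ 2 = ((lj - mi) ^ 2 * μ0) * μ0 := by ring
      _ ≤ (9 * M * C * x * m0 ^ 2 * μ0) * μ0 := mul_le_mul_of_nonneg_right hA4 hμ0.le
      _ = 9 * M * C * x * (m0 * μ0) ^ 2 := by ring
  -- Term B: `(m_iμ₀ − μ_im₀)² ≤ 36C²·x·(m₀μ₀)²`
  have hE1 : |Real.exp a - 1| ≤ 2 * |a| := Real.abs_exp_sub_one_le ha
  have hB1 : mi * μ0 - μi * m0 ≤ 2 * |a| * (μ0 * m0) := by
    calc mi * μ0 - μi * m0 ≤ (Real.exp a - 1) * (μi * m0) := by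
          calc mi * μ0 - μi * m0 ≤ Real.exp a * (μi * m0) - μi * m0 := by linarith
            _ = (Real.exp a - 1) * (μi * m0) := by ring
      _ ≤ |Real.exp a - 1| * (μi * m0) := mul_le_mul_of_nonneg_right (le_abs_self _) (by positivity)
      _ ≤ 2 * |a| * (μi * m0) := mul_le_mul_of_nonneg_right hE1 (by positivity)
      _ ≤ 2 * |a| * (μ0 * m0) := mul_le_mul_of_nonneg_left (mul_le_mul_of_nonneg_right hμle hm0.le) (by positivity)
  have hB2 : μi * m0 - mi * μ0 ≤ 6 * |a| * (μ0 * m0) := by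
    have h5 : μi * m0 - mi * μ0 ≤ (Real.exp a - 1) * (mi * μ0) := by
      calc μi * m0 - mi * μ0 ≤ Real.exp a * (mi * μ0) - mi * μ0 := by linarith
        _ = (Real.exp a - 1) * (mi * μ0) := by ring
    have h6 : mi * μ0 ≤ 3 * (μ0 * m0) := by
      calc mi * μ0 ≤ Real.exp a * (μi * m0) := h3
        _ ≤ 3 * (μ0 * m0) :=
            mul_le_mul hEa (mul_le_mul_of_nonneg_right hμle hm0.le) (by positivity) (by norm_num)
    calc μi * m0 - mi * μ0 ≤ (Real.exp a - 1) * (mi * μ0) := h5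
      _ ≤ |Real.exp a - 1| * (mi * μ0) := mul_le_mul_of_nonneg_right (le_abs_self _) (by positivity)
      _ ≤ 2 * |a| * (mi * μ0) := mul_le_mul_of_nonneg_right hE1 (by positivity)
      _ ≤ 2 * |a| * (3 * (μ0 * m0)) := mul_le_mul_of_nonneg_left h6 (by positivity)
      _ = 6 * |a| * (μ0 * m0) := by ring
  have hB : (mi * μ0 - μi * m0) ^ 2 ≤ 36 * C ^ 2 * x * (m0 * μ0) ^ 2 := by
    have hnn : 0 ≤ |a| * (μ0 * m0) := mul_nonneg (abs_nonneg a) hmm.le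
    have habs : |mi * μ0 - μi * m0| ≤ 6 * |a| * (μ0 * m0) := by
      rw [abs_le]; constructor <;> linarith
    have h7 : (mi * μ0 - μi * m0) ^ 2 ≤ (6 * |a| * (μ0 * m0)) ^ 2 := by
      calc (mi * μ0 - μi * m0) ^ 2 = |mi * μ0 - μi * m0| ^ 2 := (sq_abs _).symm
        _ ≤ (6 * |a| * (μ0 * m0)) ^ 2 := pow_le_pow_left₀ (abs_nonneg _) habs 2
    calc (mi * μ0 - μi * m0) ^ 2 ≤ (6 * |a| * (μ0 * m0)) ^ 2 := h7
      _ = 36 * |a| ^ 2 * (m0 * μ0) ^ 2 := by ring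
      _ = 36 * a ^ 2 * (m0 * μ0) ^ 2 := by rw [sq_abs]
      _ ≤ 36 * (C ^ 2 * x) * (m0 * μ0) ^ 2 :=
          mul_le_mul_of_nonneg_right (mul_le_mul_of_nonneg_left haC (by norm_num)) (sq_nonneg _)
      _ = 36 * C ^ 2 * x * (m0 * μ0) ^ 2 := by ring
  -- combine
  have hsplit : lj * μ0 - μi * m0 = (lj - mi) * μ0 + (mi * μ0 - μi * m0) := by ring
  rw [hsplit]
  calc ((lj - mi) * μ0 + (mi * μ0 - μi * m0)) ^ 2 ≤ 2 * ((lj - mi) * μ0) ^ 2 + 2 * (mi * μ0 - μi * m0) ^ 2 := by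
        nlinarith [sq_nonneg ((lj - mi) * μ0 - (mi * μ0 - μi * m0))]
    _ ≤ 2 * (9 * M * C * x * (m0 * μ0) ^ 2) + 2 * (36 * C ^ 2 * x * (m0 * μ0) ^ 2) := by linarith [hA, hB]
    _ = (18 * M * C + 72 * C ^ 2) * x * (m0 * μ0) ^ 2 := by ring

/-! ## §2 ★★ The handover shadow along the femto window -/
set_option maxHeartbeats 400000 in
/-- ★★ **HANDOVER SHADOW of item 20205's level-`k` slice** (RED's product currency, index-free): if `DressedRitzAt k` holds then for every `η > 0`,
eventually in the femto window, the slice's family `φ₀ … φ_k` (physical, `l2`-orthonormal, `m_i > 0`, `m₀ ≤ λ₀ ≤ e^{ηΛ/L}m₀`) satisfies: for every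
`i ≤ k` SOME running zero-flux level `λ_j` has `(λ_j·μ₀ − μ_i·m₀)² ≤ C'·(Λ³/L²)·(m₀μ₀)²` (`μ_j` the one-site levels at `B = 2L³/Λ³`).
[cite: Kato1949, Lemma 1] [cite: Luscher1983, §3] -/
theorem KTGen.handoverShadow_of_dressedRitzAt {k : ℕ} (h : KTGen.DressedRitzAt k) :
    ∀ η : ℝ, 0 < η → ∃ C lam0 : ℝ, 0 ≤ C ∧ 0 < lam0 ∧ ∀ lam : ℝ, 0 < lam → lam ≤ lam0 →
      ∃ L0 : ℕ, ∀ (L : ℕ) [NeZero L], L0 ≤ L → ∀ β : ℝ, InFemtoWindow lam β L →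
        ∃ φ : Fin (k + 1) → (GaugeConfig 3 L SU2 → ℝ),
          (∀ i, IsPhys (φ i)) ∧
          (∀ i l, l2 (φ i) (φ l) = if i = l then 1 else 0) ∧
          (∀ i, 0 < qform su2Rep β (φ i) (φ i)) ∧
          qform su2Rep β (φ 0) (φ 0) ≤ levelValue su2Rep L β 0 ∧
          levelValue su2Rep L β 0 ≤ Real.exp (η * luscherLambda β L / L) * qform su2Rep β (φ 0) (φ 0) ∧
          (∀ i : Fin (k + 1), ∃ j : ℕ,
            (levelValue su2Rep L β j * levelValue su2Rep 1 (oneSiteCoupling β L) 0 -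
                levelValue su2Rep 1 (oneSiteCoupling β L) i * qform su2Rep β (φ 0) (φ 0)) ^ 2 ≤
              C * (luscherLambda β L ^ 3 / (L : ℝ) ^ 2) *
                (qform su2Rep β (φ 0) (φ 0) * levelValue su2Rep 1 (oneSiteCoupling β L) 0) ^ 2) := by
  intro η hη
  obtain ⟨C, lam0, hlam0, hC⟩ := KTGen.locatedLevels_of_dressedRitzAt h η hη
  obtain ⟨C1, B0, hB0⟩ := oneSiteLevels_proof k
  set Cp : ℝ := |C| with hCp
  have hCp0 : 0 ≤ Cp := abs_nonneg C
  set M : ℝ := Real.exp (|levelGap k| + |C1|) with hM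
  refine ⟨18 * M * Cp + 72 * Cp ^ 2,
    min lam0 (min (1 / 2) (min (1 / (4 * max B0 1)) (min (1 / (4 * Cp + 1)) (1 / (2 * η + 1))))),
    by positivity, lt_min hlam0 (lt_min (by norm_num) (lt_min (by positivity) (lt_min (by positivity) (by positivity)))),
    fun lam hlam hle => ?_⟩
  have hle0 : lam ≤ lam0 := hle.trans (min_le_left _ _)
  have hle2 : lam ≤ 1 / 2 := hle.trans ((min_le_right _ _).trans (min_le_left _ _))
  have hle1 : lam ≤ 1 := hle2.trans (by norm_num)
  have hleB : lam ≤ 1 / (4 * max B0 1) := hle.trans ((min_le_right _ _).trans ((min_le_right _ _).trans (min_le_left _ _)))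
  have hleC : lam ≤ 1 / (4 * Cp + 1) :=
    hle.trans ((min_le_right _ _).trans ((min_le_right _ _).trans ((min_le_right _ _).trans (min_le_left _ _))))
  have hleη : lam ≤ 1 / (2 * η + 1) :=
    hle.trans ((min_le_right _ _).trans ((min_le_right _ _).trans ((min_le_right _ _).trans (min_le_right _ _))))
  obtain ⟨L0, hL0⟩ := hC lam hlam hle0
  refine ⟨L0, fun L _ hL β hW => ?_⟩
  obtain ⟨φ, hφ, hon, hpos, htop, hmpos, hcap, hloc⟩ := hL0 L hL β hW
  -- window facts
  set Λ := luscherLambda β L with hΛdef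
  have hΛpos : 0 < Λ := luscherLambda_pos_of_window hlam hW
  have hΛle1 : Λ ≤ 1 := by have := hW.2.2; linarith
  have hL1 : (1 : ℝ) ≤ L := by exact_mod_cast NeZero.one_le
  have hLpos : (0 : ℝ) < L := by positivity
  -- the one-site levels at `B = oneSiteCoupling β L`
  set B := oneSiteCoupling β L with hBdef
  have hBge : B0 ≤ B := oneSiteCoupling_ge_of_small_level hlam hle1 hleB hW
  have hBpos : 0 < B := lt_of_lt_of_le (by positivity) (oneSiteCoupling_ge_of_window hlam hW)
  obtain ⟨hμ0, -, hμk⟩ := hB0 B hBge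
  have hlb : bareLambda B = Λ / L := bareLambda_oneSiteCoupling hΛpos
  have hlb0 : 0 ≤ bareLambda B := by rw [hlb]; positivity
  have hlb1 : bareLambda B ≤ 1 := by
    rw [hlb, div_le_iff₀ hLpos]; nlinarith
  have hexpo : levelGap k * bareLambda B + C1 * bareLambda B ^ 2 ≤ |levelGap k| + |C1| := by
    have h1 : levelGap k * bareLambda B ≤ |levelGap k| := by
      calc levelGap k * bareLambda B ≤ |levelGap k| * bareLambda B :=
            mul_le_mul_of_nonneg_right (le_abs_self _) hlb0
        _ ≤ |levelGap k| * 1 := mul_le_mul_of_nonneg_left hlb1 (abs_nonneg _)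
        _ = |levelGap k| := mul_one _
    have h2 : C1 * bareLambda B ^ 2 ≤ |C1| := by
      calc C1 * bareLambda B ^ 2 ≤ |C1| * bareLambda B ^ 2 := mul_le_mul_of_nonneg_right (le_abs_self _) (sq_nonneg _)
        _ ≤ |C1| * 1 := mul_le_mul_of_nonneg_left (by nlinarith) (abs_nonneg _)
        _ = |C1| := mul_one _
    linarith
  have hμM : ∀ i : Fin (k + 1), levelValue su2Rep 1 B 0 ≤ M * levelValue su2Rep 1 B i := by
    intro i
    have hki : levelValue su2Rep 1 B k ≤ levelValue su2Rep 1 B i :=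
      levelValue_antitone (L := 1) hBpos.le (Nat.le_of_lt_succ i.isLt)
    have hM1 : M * Real.exp (-(|levelGap k| + |C1|)) = 1 := by
      rw [hM, ← Real.exp_add, add_neg_cancel, Real.exp_zero]
    have hexp : Real.exp (-(|levelGap k| + |C1|)) ≤ Real.exp (-(levelGap k * bareLambda B + C1 * bareLambda B ^ 2)) :=
      Real.exp_le_exp.2 (by linarith)
    calc levelValue su2Rep 1 B 0 = M * (Real.exp (-(|levelGap k| + |C1|)) * levelValue su2Rep 1 B 0) := by
          rw [← mul_assoc, hM1, one_mul]
      _ ≤ M * (Real.exp (-(levelGap k * bareLambda B + C1 * bareLambda B ^ 2)) * levelValue su2Rep 1 B 0) :=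
          mul_le_mul_of_nonneg_left (mul_le_mul_of_nonneg_right hexp hμ0.le) (Real.exp_pos _).le
      _ ≤ M * levelValue su2Rep 1 B k := mul_le_mul_of_nonneg_left hμk (Real.exp_pos _).le
      _ ≤ M * levelValue su2Rep 1 B i := mul_le_mul_of_nonneg_left hki (Real.exp_pos _).le
  have hμle : ∀ i : Fin (k + 1), levelValue su2Rep 1 B i ≤ levelValue su2Rep 1 B 0 := fun i =>
    levelValue_antitone (L := 1) hBpos.le (Nat.zero_le _)
  have hμpos : ∀ i : Fin (k + 1), 0 < levelValue su2Rep 1 B i := fun i => by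
    have hMpos : 0 < M := Real.exp_pos _
    have := hμM i
    by_contra hneg
    push Not at hneg
    have : M * levelValue su2Rep 1 B i ≤ 0 := mul_nonpos_of_nonneg_of_nonpos hMpos.le hneg
    linarith
  -- `m₀ ≤ λ₀`
  have hm0le : qform su2Rep β (φ 0) (φ 0) ≤ levelValue su2Rep L β 0 := by
    have := VacDict.qform_self_le_levelValue_zero_mul β (hφ 0)
    rw [hon 0 0, if_pos rfl, mul_one] at this
    exact this
  -- the two small parameters `a = |C|Λ²/L`, `b = ηΛ/L`
  have ha0 : 0 ≤ Cp * Λ ^ 2 / L := by positivity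
  have ha1 : Cp * Λ ^ 2 / L ≤ 1 := by
    have hΛ2 : Λ ^ 2 ≤ 4 * lam ^ 2 := by have := hW.2.2; nlinarith
    have h4 : 4 * Cp * lam ≤ 1 := by
      have := (le_div_iff₀ (by positivity : (0 : ℝ) < 4 * Cp + 1)).mp hleC
      nlinarith
    calc Cp * Λ ^ 2 / L ≤ Cp * Λ ^ 2 / 1 := div_le_div_of_nonneg_left (by positivity) one_pos hL1
      _ = Cp * Λ ^ 2 := div_one _
      _ ≤ Cp * (4 * lam ^ 2) := mul_le_mul_of_nonneg_left hΛ2 hCp0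
      _ = (4 * Cp * lam) * lam := by ring
      _ ≤ 1 * 1 := mul_le_mul h4 hle1 hlam.le zero_le_one
      _ = 1 := one_mul _
  have haabs : |Cp * Λ ^ 2 / L| ≤ 1 := by rw [abs_of_nonneg ha0]; exact ha1
  have haC : (Cp * Λ ^ 2 / L) ^ 2 ≤ Cp ^ 2 * (Λ ^ 3 / (L : ℝ) ^ 2) := by
    have hΛ43 : Λ ^ 4 ≤ Λ ^ 3 := by
      calc Λ ^ 4 = Λ ^ 3 * Λ := by ring
        _ ≤ Λ ^ 3 * 1 := mul_le_mul_of_nonneg_left hΛle1 (by positivity)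
        _ = Λ ^ 3 := mul_one _
    calc (Cp * Λ ^ 2 / L) ^ 2 = Cp ^ 2 * (Λ ^ 4 / (L : ℝ) ^ 2) := by ring
      _ ≤ Cp ^ 2 * (Λ ^ 3 / (L : ℝ) ^ 2) :=
          mul_le_mul_of_nonneg_left (div_le_div_of_nonneg_right hΛ43 (by positivity)) (sq_nonneg _)
  have hb1 : η * Λ / L ≤ 1 := by
    have h2η : 2 * η * lam ≤ 1 := by
      have := (le_div_iff₀ (by positivity : (0 : ℝ) < 2 * η + 1)).mp hleη
      nlinarith
    calc η * Λ / L ≤ η * Λ / 1 := div_le_div_of_nonneg_left (by positivity) one_pos hL1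
      _ = η * Λ := div_one _
      _ ≤ η * (2 * lam) := mul_le_mul_of_nonneg_left hW.2.2 hη.le
      _ = 2 * η * lam := by ring
      _ ≤ 1 := h2η
  have hexpmono : Real.exp (C * Λ ^ 2 / L) ≤ Real.exp (Cp * Λ ^ 2 / L) :=
    Real.exp_le_exp.2 (div_le_div_of_nonneg_right (mul_le_mul_of_nonneg_right (le_abs_self C) (sq_nonneg _)) hLpos.le)
  refine ⟨φ, hφ, hon, hmpos, hm0le, hcap, fun i => ?_⟩
  obtain ⟨j, hj⟩ := hloc i
  refine ⟨j, ?_⟩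
  have h1 : (levelValue su2Rep L β j - qform su2Rep β (φ i) (φ i)) ^ 2 * qform su2Rep β (φ i) (φ i) ≤
      Cp * (Λ ^ 3 / (L : ℝ) ^ 2) * qform su2Rep β (φ 0) (φ 0) ^ 2 * levelValue su2Rep L β 0 := by
    refine hj.trans ?_
    have hnn : 0 ≤ (Λ ^ 3 / (L : ℝ) ^ 2) * qform su2Rep β (φ 0) (φ 0) ^ 2 * levelValue su2Rep L β 0 := by
      have := (levelValue_zero_su2Rep_pos L β).le
      positivity
    calc C * (Λ ^ 3 / (L : ℝ) ^ 2) * qform su2Rep β (φ 0) (φ 0) ^ 2 * levelValue su2Rep L β 0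
        = C * ((Λ ^ 3 / (L : ℝ) ^ 2) * qform su2Rep β (φ 0) (φ 0) ^ 2 * levelValue su2Rep L β 0) := by ring
      _ ≤ Cp * ((Λ ^ 3 / (L : ℝ) ^ 2) * qform su2Rep β (φ 0) (φ 0) ^ 2 * levelValue su2Rep L β 0) :=
          mul_le_mul_of_nonneg_right (le_abs_self C) hnn
      _ = _ := by ring
  obtain ⟨he1, he2⟩ := hpos i
  have h2 : levelValue su2Rep 1 B i * qform su2Rep β (φ 0) (φ 0) ≤
      Real.exp (Cp * Λ ^ 2 / L) * (qform su2Rep β (φ i) (φ i) * levelValue su2Rep 1 B 0) :=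
    he2.trans (mul_le_mul_of_nonneg_right hexpmono (mul_pos (hmpos i) hμ0).le)
  have h3 : qform su2Rep β (φ i) (φ i) * levelValue su2Rep 1 B 0 ≤
      Real.exp (Cp * Λ ^ 2 / L) * (levelValue su2Rep 1 B i * qform su2Rep β (φ 0) (φ 0)) :=
    he1.trans (mul_le_mul_of_nonneg_right hexpmono (mul_pos (hμpos i) (hmpos 0)).le)
  have key := KTGen.shadow_sq_algebra (lj := levelValue su2Rep L β j) (mi := qform su2Rep β (φ i) (φ i))
    (m0 := qform su2Rep β (φ 0) (φ 0)) (μi := levelValue su2Rep 1 B i) (μ0 := levelValue su2Rep 1 B 0)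
    (l0 := levelValue su2Rep L β 0) (C := Cp) (x := Λ ^ 3 / (L : ℝ) ^ 2) (a := Cp * Λ ^ 2 / L) (b := η * Λ / L) (M := M)
    (hmpos i) (hmpos 0) (hμpos i) hμ0 hCp0 (by positivity) haabs hb1 haC (hμM i) (hμle i)
    (by
      calc (levelValue su2Rep L β j - qform su2Rep β (φ i) (φ i)) ^ 2 * qform su2Rep β (φ i) (φ i)
          ≤ Cp * (Λ ^ 3 / (L : ℝ) ^ 2) * qform su2Rep β (φ 0) (φ 0) ^ 2 * levelValue su2Rep L β 0 := h1
        _ = Cp * (Λ ^ 3 / (L : ℝ) ^ 2) * qform su2Rep β (φ 0) (φ 0) ^ 2 * levelValue su2Rep L β 0 := rfl)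
    h2 h3 hcap
  exact key

/-- **The same for the item BY NAME**: `DressedRitz` (stmt-QuantumFields-20205) implies the handover shadow at every level `k`.
[cite: Kato1949, Lemma 1] [cite: Luscher1983, §3] -/
theorem KTGen.handoverShadow_of_dressedRitz (h : Summit.QuantumFields.YangMills.Theses.LuscherReduction.DressedRitz) (k : ℕ) :
    ∀ η : ℝ, 0 < η → ∃ C lam0 : ℝ, 0 ≤ C ∧ 0 < lam0 ∧ ∀ lam : ℝ, 0 < lam → lam ≤ lam0 →
      ∃ L0 : ℕ, ∀ (L : ℕ) [NeZero L], L0 ≤ L → ∀ β : ℝ, InFemtoWindow lam β L →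
        ∃ φ : Fin (k + 1) → (GaugeConfig 3 L SU2 → ℝ),
          (∀ i, IsPhys (φ i)) ∧
          (∀ i l, l2 (φ i) (φ l) = if i = l then 1 else 0) ∧
          (∀ i, 0 < qform su2Rep β (φ i) (φ i)) ∧
          qform su2Rep β (φ 0) (φ 0) ≤ levelValue su2Rep L β 0 ∧
          levelValue su2Rep L β 0 ≤ Real.exp (η * luscherLambda β L / L) * qform su2Rep β (φ 0) (φ 0) ∧
          (∀ i : Fin (k + 1), ∃ j : ℕ,
            (levelValue su2Rep L β j * levelValue su2Rep 1 (oneSiteCoupling β L) 0 -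
                levelValue su2Rep 1 (oneSiteCoupling β L) i * qform su2Rep β (φ 0) (φ 0)) ^ 2 ≤
              C * (luscherLambda β L ^ 3 / (L : ℝ) ^ 2) *
                (qform su2Rep β (φ 0) (φ 0) * levelValue su2Rep 1 (oneSiteCoupling β L) 0) ^ 2) :=
  KTGen.handoverShadow_of_dressedRitzAt (KTGen.dressedRitz_iff_forall_dressedRitzAt.mp h k)

end Summit.QuantumFields.YangMills.Theorems.FemtoTransferGap

end
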